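import Summits.Ventures.HodgeRepro2.T5HeckeSimpleInvariants

/-!
# Commutative Hecke algebra ⇒ spherical vectors are unique up to scalar

Let `π` be an irreducible `K`-finite representation (char 0, every double coset `KgK/K` finite)
with `π^K ≠ 0`, over an algebraically closed field, with `π^K` finite-dimensional (admissibility at
level `K`).  If the Hecke algebra `H(G, K)` is COMMUTATIVE then every `T ∈ H(G, K)` acts on `π^K`
by a scalar (`exists_forall_heckeSMul_eq_smul`), these scalars form the Hecke eigencharacter
`heckeCharacter : H(G, K) →ₐ[k] k` (`heckeCharacterAlgHom`), and `dim π^K = 1`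
(`finrank_invariants_eq_one`): the spherical vector is unique up to scalar.

Proof: a Hecke operator `T` has an eigenvalue `c` on the finite-dimensional `π^K`; its
`c`-eigenspace is Hecke-stable because `H(G, K)` is commutative, hence (`π^K` being a simple
Hecke module, `T5HeckeSimpleInvariants`) it is all of `π^K`.  Then every line `k · v` is
Hecke-stable, hence all of `π^K`.

The commutativity of `H(G, K)` for a hyperspecial `K` (the Satake / Gelfand-pair theorem) is the
printed input; it enters only as the hypothesis `hcomm`.
-/

namespace Summit.Ventures.HodgeRepro2.T5HeckeCommutativeMultiplicityOne

open T5HeckePermutationModule T5HeckeSimpleInvariants LevelPositivity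

variable {G : Type*} [Group G] {k : Type*} [Field k] {V : Type*} [AddCommGroup V] [Module k V]
  (ρ : Representation k G V) {K : Subgroup G}

/-- For a commutative Hecke algebra the eigenspaces of a Hecke operator are Hecke-stable. -/
theorem isHeckeSubmodule_eigenspace (hcomm : ∀ T S : heckeAlgebra k K, T * S = S * T)
    (T : heckeAlgebra k K) (c : k) :
    IsHeckeSubmodule ρ (Module.End.eigenspace (heckeEnd ρ T) c) := by
  intro S m hm
  rw [Module.End.mem_eigenspace_iff, heckeEnd_apply] at hm ⊢
  rw [← heckeSMul_mul, hcomm S T, heckeSMul_mul, hm, ← heckeEnd_apply, map_smul, heckeEnd_apply]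

variable [CharZero k] [ρ.IsIrreducible] (hK : T5LevelIdempotent.KFinite ρ K)
  (hfin : ∀ g : G, Finite (MulAction.orbit K (g : G ⧸ K)))

include hK hfin

/-- EVERY HECKE OPERATOR ACTS ON `π^K` BY A SCALAR when `H(G, K)` is commutative, `π` is
irreducible `K`-finite with `π^K ≠ 0` finite-dimensional, `k` algebraically closed. -/
theorem exists_forall_heckeSMul_eq_smul [IsAlgClosed k] [FiniteDimensional k (invariants ρ K)]
    (hne : invariants ρ K ≠ ⊥) (hcomm : ∀ T S : heckeAlgebra k K, T * S = S * T)
    (T : heckeAlgebra k K) : ∃ c : k, ∀ m : invariants ρ K, heckeSMul ρ T m = c • m := by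
  haveI : Nontrivial (invariants ρ K) := Submodule.nontrivial_iff_ne_bot.2 hne
  obtain ⟨c, hc⟩ := Module.End.exists_eigenvalue (heckeEnd ρ T)
  refine ⟨c, fun m => ?_⟩
  rcases eq_bot_or_eq_top_of_isHeckeSubmodule ρ hK hfin (isHeckeSubmodule_eigenspace ρ hcomm T c)
    with h | h
  · exact absurd h (Module.End.hasEigenvalue_iff.1 hc)
  · have hm : m ∈ Module.End.eigenspace (heckeEnd ρ T) c := by
      rw [h]
      exact Submodule.mem_top
    rw [Module.End.mem_eigenspace_iff, heckeEnd_apply] at hm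
    exact hm

/-- A line `k · v` in `π^K` is Hecke-stable when every Hecke operator acts by a scalar. -/
theorem span_singleton_eq_top_of_ne_zero [IsAlgClosed k] [FiniteDimensional k (invariants ρ K)]
    (hcomm : ∀ T S : heckeAlgebra k K, T * S = S * T) {v : invariants ρ K} (hv : v ≠ 0) :
    (k ∙ v) = ⊤ := by
  have hne : invariants ρ K ≠ ⊥ := by
    intro h
    apply hv
    apply Subtype.ext
    exact (Submodule.eq_bot_iff _).1 h (v : V) v.2
  have hH : IsHeckeSubmodule ρ (k ∙ v) := by
    intro T m hm
    obtain ⟨c, hc⟩ := exists_forall_heckeSMul_eq_smul ρ hK hfin hne hcomm T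
    rw [hc m]
    exact Submodule.smul_mem _ c hm
  rcases eq_bot_or_eq_top_of_isHeckeSubmodule ρ hK hfin hH with h | h
  · exact absurd (Submodule.span_singleton_eq_bot.1 h) hv
  · exact h

/-- MULTIPLICITY ONE FOR SPHERICAL VECTORS: `dim π^K = 1` when `H(G, K)` is commutative, `π` is
irreducible `K`-finite with `π^K ≠ 0` finite-dimensional, `k` algebraically closed. -/
theorem finrank_invariants_eq_one [IsAlgClosed k] [FiniteDimensional k (invariants ρ K)]
    (hne : invariants ρ K ≠ ⊥) (hcomm : ∀ T S : heckeAlgebra k K, T * S = S * T) :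
    Module.finrank k (invariants ρ K) = 1 := by
  haveI : Nontrivial (invariants ρ K) := Submodule.nontrivial_iff_ne_bot.2 hne
  obtain ⟨v, hv⟩ := exists_ne (0 : invariants ρ K)
  rw [← finrank_top, ← span_singleton_eq_top_of_ne_zero ρ hK hfin hcomm hv, finrank_span_singleton hv]

section Character

variable [IsAlgClosed k] [FiniteDimensional k (invariants ρ K)]
  (hne : invariants ρ K ≠ ⊥) (hcomm : ∀ T S : heckeAlgebra k K, T * S = S * T)

include hne hcomm

/-- THE HECKE EIGENCHARACTER of the spherical vector: the scalar by which `T` acts on `π^K`. -/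
noncomputable def heckeCharacter (T : heckeAlgebra k K) : k :=
  Classical.choose (exists_forall_heckeSMul_eq_smul ρ hK hfin hne hcomm T)

/-- `T • m = heckeCharacter T • m` on `π^K`. -/
theorem heckeSMul_eq_heckeCharacter_smul (T : heckeAlgebra k K) (m : invariants ρ K) :
    heckeSMul ρ T m = heckeCharacter ρ hK hfin hne hcomm T • m :=
  Classical.choose_spec (exists_forall_heckeSMul_eq_smul ρ hK hfin hne hcomm T) m

/-- The eigencharacter is determined by its value on any non-zero vector. -/
theorem heckeCharacter_eq_of_smul_eq {T : heckeAlgebra k K} {v : invariants ρ K} (hv : v ≠ 0)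
    {c : k} (h : heckeSMul ρ T v = c • v) : heckeCharacter ρ hK hfin hne hcomm T = c :=
  smul_left_injective k hv (by
    show heckeCharacter ρ hK hfin hne hcomm T • v = c • v
    rw [← heckeSMul_eq_heckeCharacter_smul, h])

/-- The eigencharacter is multiplicative. -/
theorem heckeCharacter_mul (T S : heckeAlgebra k K) :
    heckeCharacter ρ hK hfin hne hcomm (T * S) =
      heckeCharacter ρ hK hfin hne hcomm T * heckeCharacter ρ hK hfin hne hcomm S := by
  haveI : Nontrivial (invariants ρ K) := Submodule.nontrivial_iff_ne_bot.2 hne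
  obtain ⟨v, hv⟩ := exists_ne (0 : invariants ρ K)
  apply heckeCharacter_eq_of_smul_eq ρ hK hfin hne hcomm hv
  rw [heckeSMul_mul, heckeSMul_eq_heckeCharacter_smul ρ hK hfin hne hcomm T, ← heckeEnd_apply,
    map_smul, heckeEnd_apply, heckeSMul_eq_heckeCharacter_smul ρ hK hfin hne hcomm S, smul_smul,
    mul_comm]

/-- The eigencharacter is additive. -/
theorem heckeCharacter_add (T S : heckeAlgebra k K) :
    heckeCharacter ρ hK hfin hne hcomm (T + S) =
      heckeCharacter ρ hK hfin hne hcomm T + heckeCharacter ρ hK hfin hne hcomm S := by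
  haveI : Nontrivial (invariants ρ K) := Submodule.nontrivial_iff_ne_bot.2 hne
  obtain ⟨v, hv⟩ := exists_ne (0 : invariants ρ K)
  apply heckeCharacter_eq_of_smul_eq ρ hK hfin hne hcomm hv
  rw [heckeSMul_add_left, heckeSMul_eq_heckeCharacter_smul ρ hK hfin hne hcomm T,
    heckeSMul_eq_heckeCharacter_smul ρ hK hfin hne hcomm S, add_smul]

/-- The eigencharacter is `k`-linear. -/
theorem heckeCharacter_smul (c : k) (T : heckeAlgebra k K) :
    heckeCharacter ρ hK hfin hne hcomm (c • T) = c * heckeCharacter ρ hK hfin hne hcomm T := by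
  haveI : Nontrivial (invariants ρ K) := Submodule.nontrivial_iff_ne_bot.2 hne
  obtain ⟨v, hv⟩ := exists_ne (0 : invariants ρ K)
  apply heckeCharacter_eq_of_smul_eq ρ hK hfin hne hcomm hv
  rw [heckeSMul_smul_left, heckeSMul_eq_heckeCharacter_smul ρ hK hfin hne hcomm T, smul_smul]

/-- The eigencharacter is unital. -/
theorem heckeCharacter_one : heckeCharacter ρ hK hfin hne hcomm 1 = 1 := by
  haveI : Nontrivial (invariants ρ K) := Submodule.nontrivial_iff_ne_bot.2 hne
  obtain ⟨v, hv⟩ := exists_ne (0 : invariants ρ K)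
  apply heckeCharacter_eq_of_smul_eq ρ hK hfin hne hcomm hv
  rw [heckeSMul_one, one_smul]

/-- THE HECKE EIGENCHARACTER AS AN ALGEBRA HOMOMORPHISM `H(G, K) →ₐ[k] k`. -/
noncomputable def heckeCharacterAlgHom : heckeAlgebra k K →ₐ[k] k where
  toFun := heckeCharacter ρ hK hfin hne hcomm
  map_one' := heckeCharacter_one ρ hK hfin hne hcomm
  map_mul' := heckeCharacter_mul ρ hK hfin hne hcomm
  map_zero' := by
    have h := heckeCharacter_smul ρ hK hfin hne hcomm 0 0
    rw [zero_smul, zero_mul] at h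
    exact h
  map_add' := heckeCharacter_add ρ hK hfin hne hcomm
  commutes' c := by
    show heckeCharacter ρ hK hfin hne hcomm (algebraMap k (heckeAlgebra k K) c) = algebraMap k k c
    rw [Algebra.algebraMap_eq_smul_one, heckeCharacter_smul, heckeCharacter_one, mul_one,
      Algebra.algebraMap_self_apply]

/-- The eigencharacter algebra homomorphism acts as claimed. -/
theorem heckeCharacterAlgHom_apply (T : heckeAlgebra k K) :
    heckeCharacterAlgHom ρ hK hfin hne hcomm T = heckeCharacter ρ hK hfin hne hcomm T := rfl

end Character

end Summit.Ventures.HodgeRepro2.T5HeckeCommutativeMultiplicityOne
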